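import Mathlib.Analysis.SpecialFunctions.Log.Basic
import Mathlib.Algebra.Order.BigOperators.Group.Finset
import HarnessLib

/-!
# The flow of the running coupling over `|h_β| ≲ 1/|U|` scales (BGM 2006, (3.66)–(3.70))

Topic `Literature/MathematicalPhysics/QuantumLattice`.  The reason for the hypothesis
`β ≤ e^{c/|U|}` ("temperatures larger than an exponentially small one") in the Fermi-liquid theorem of
Benfatto–Giuliani–Mastropietro 2006 is the control of the running coupling `λ_h` down to the
temperature scale `h_β` (`γ^{h_β} ≈ π/β`): by the beta-function equation
`λ̃_j = λ₀ + Σ_{j'=j+1}^{0} β⁴_{j'}` ((3.66)) and the inductive bound `|β⁴_{j'}| ≤ c|U|²` — valid as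
long as the couplings on the higher scales obey the smallness condition `|λ̃| ≤ C|U|` ((2.71a)) —
one gets `|λ̃_j| ≤ C₀|U| + c|j||U|² ≤ C|U|` "where in the last passage we used that `|j||U| ≤ c₀`"
((3.70)), `U₀|h_β| = c₀` being the smallness condition of Theorem 2.1.  This file isolates the two
elementary facts:

* `abs_le_of_conditional_increments` — the induction (3.66)–(3.70): a sequence
  `λ_k = λ₀ + Σ_{k' < k} β_{k'}` whose increments satisfy `|β_k| ≤ c ε²` *whenever* `|λ_{k'}| ≤ C ε`
  for all `k' ≤ k`, with `|λ₀| ≤ C₀ ε` and `C₀ + c ε N ≤ C`, satisfies `|λ_k| ≤ C ε` for all `k ≤ N`;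
* `log_div_log_mul_le_iff` — the number of scales `N = log β / log γ` above the temperature obeys
  `N |U| ≤ c₀ / log γ` exactly when `β ≤ exp (c₀/|U|)`.

Everything is proved; no named fact. [folklore]

## Sources

G. Benfatto, A. Giuliani, V. Mastropietro, Ann. Henri Poincaré 7 (2006), Thm. 2.1 (the condition
`U₀|h_β| = c₀`), §3 (3.65)–(3.70) (`BenfattoGiulianiMastropietro2006`); V. Mastropietro,
*Non-Perturbative Renormalization* (2008), Ch. 11 (flow of the running coupling constants at finite
temperature) (`Mastropietro2008`).
-/

noncomputable section

open Finset

namespace Literature.MathematicalPhysics.QuantumLattice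

/-- **The running coupling stays small over `N ≲ 1/ε` scales** (Benfatto–Giuliani–Mastropietro
2006, (3.66)–(3.70)): if `λ_k = λ₀ + Σ_{k' < k} β_{k'}`, `|λ₀| ≤ C₀ ε`, the increments obey
`|β_k| ≤ c ε²` whenever all the couplings `λ_{k'}`, `k' ≤ k`, obey `|λ_{k'}| ≤ C ε` (the inductive
bound on the beta function under the smallness condition (2.71a)), and `C₀ + c ε N ≤ C`, then
`|λ_k| ≤ C ε` for every `k ≤ N`. [cite: BenfattoGiulianiMastropietro2006, §3 (3.66)-(3.70)] -/
theorem abs_le_of_conditional_increments (lam beta : ℕ → ℝ) {ε C₀ C c : ℝ} {N : ℕ} (hε : 0 ≤ ε)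
    (hlam : ∀ k, lam k = lam 0 + ∑ k' ∈ range k, beta k') (h0 : |lam 0| ≤ C₀ * ε)
    (hbeta : ∀ k, k < N → (∀ k' ≤ k, |lam k'| ≤ C * ε) → |beta k| ≤ c * ε ^ 2)
    (hc : 0 ≤ c) (hN : C₀ + c * ε * N ≤ C) : ∀ k ≤ N, |lam k| ≤ C * ε := by
  have hC₀ : C₀ * ε ≤ C * ε := by
    refine mul_le_mul_of_nonneg_right ?_ hε
    have : 0 ≤ c * ε * N := by positivity
    linarith
  intro k
  induction k using Nat.strong_induction_on with
  | _ k ih =>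
    intro hk
    cases k with
    | zero => exact h0.trans hC₀
    | succ k =>
      have hprev : ∀ k' ≤ k, |lam k'| ≤ C * ε := fun k' hk' => ih k' (Nat.lt_succ_of_le hk') (by omega)
      have hincr : ∀ k' ∈ range (k + 1), |beta k'| ≤ c * ε ^ 2 := fun k' hk' =>
        hbeta k' (by have := mem_range.1 hk'; omega) fun k'' hk'' => hprev k'' (by have := mem_range.1 hk'; omega)
      calc |lam (k + 1)| = |lam 0 + ∑ k' ∈ range (k + 1), beta k'| := by rw [hlam (k + 1)]
        _ ≤ |lam 0| + ∑ k' ∈ range (k + 1), |beta k'| := (abs_add_le _ _).trans (by gcongr; exact abs_sum_le_sum_abs _ _)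
        _ ≤ C₀ * ε + ∑ _k' ∈ range (k + 1), c * ε ^ 2 := add_le_add h0 (sum_le_sum hincr)
        _ = C₀ * ε + c * ε * (k + 1 : ℕ) * ε := by rw [sum_const, card_range, nsmul_eq_mul]; push_cast; ring
        _ ≤ C₀ * ε + c * ε * N * ε := by gcongr
        _ = (C₀ + c * ε * N) * ε := by ring
        _ ≤ C * ε := mul_le_mul_of_nonneg_right hN hε

/-- **`β ≤ e^{c₀/|U|}` is the condition `|h_β| |U| ≤ const`**: with `N = log β / log γ` the number
of scales between the ultraviolet scale and the temperature scale (`γ > 1` the scaling parameter,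
`γ^{-N} = 1/β`), `N |U| ≤ c₀ / log γ ↔ β ≤ exp (c₀ / |U|)` (`β > 0`, `U ≠ 0`). [folklore] -/
theorem log_div_log_mul_le_iff {γ β U c₀ : ℝ} (hγ : 1 < γ) (hβ : 0 < β) (hU : U ≠ 0) :
    Real.log β / Real.log γ * |U| ≤ c₀ / Real.log γ ↔ β ≤ Real.exp (c₀ / |U|) := by
  have hlogγ : 0 < Real.log γ := Real.log_pos hγ
  have hUpos : 0 < |U| := abs_pos.2 hU
  rw [div_mul_eq_mul_div, div_le_div_iff_of_pos_right hlogγ, ← le_div_iff₀ hUpos, Real.log_le_iff_le_exp hβ]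

/-- The two facts combined, in the form used for the Hubbard model: if the increments of the running
coupling are conditionally bounded by `c U²` over the `⌊log β / log γ⌋₊` scales above the temperature
and `β ≤ exp (c₀/|U|)` with `C₀ + c c₀ / log γ ≤ C`, then the coupling stays bounded by `C|U|` on
all these scales. [folklore] -/
theorem runningCoupling_abs_le (lam beta : ℕ → ℝ) {γ β U C₀ C c c₀ : ℝ} (hγ : 1 < γ) (hβ : 1 ≤ β) (hU : U ≠ 0)
    (hlam : ∀ k, lam k = lam 0 + ∑ k' ∈ range k, beta k') (h0 : |lam 0| ≤ C₀ * |U|)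
    (hbeta : ∀ k, k < ⌊Real.log β / Real.log γ⌋₊ → (∀ k' ≤ k, |lam k'| ≤ C * |U|) → |beta k| ≤ c * |U| ^ 2)
    (hc : 0 ≤ c) (hC : C₀ + c * (c₀ / Real.log γ) ≤ C) (hβU : β ≤ Real.exp (c₀ / |U|)) :
    ∀ k ≤ ⌊Real.log β / Real.log γ⌋₊, |lam k| ≤ C * |U| := by
  have hlogγ : 0 < Real.log γ := Real.log_pos hγ
  have hNU : Real.log β / Real.log γ * |U| ≤ c₀ / Real.log γ :=
    (log_div_log_mul_le_iff hγ (by linarith) hU).2 hβU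
  have hN0 : 0 ≤ Real.log β / Real.log γ := div_nonneg (Real.log_nonneg hβ) hlogγ.le
  refine abs_le_of_conditional_increments lam beta (abs_nonneg U) hlam h0 hbeta hc ?_
  calc C₀ + c * |U| * (⌊Real.log β / Real.log γ⌋₊ : ℕ)
      ≤ C₀ + c * |U| * (Real.log β / Real.log γ) := by gcongr; exact Nat.floor_le hN0
    _ = C₀ + c * (Real.log β / Real.log γ * |U|) := by ring
    _ ≤ C₀ + c * (c₀ / Real.log γ) := by gcongr
    _ ≤ C := hC

end Literature.MathematicalPhysics.QuantumLattice
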